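import Summits.QuantumFields.YangMills.Theorems.OneCertifiedCubeCrossoverCertificateDefs

/-!
# Elementary trigonometric inequalities: strong concavity of `cos` with an explicit margin
(helper file for the frozen-coupling analysis of crux `CrossoverCertificate`, stmt-QuantumFields-16125)

We record a pointwise second-order concavity bound for `cos` around a small base point `a`
(with an explicit quadratic margin `(θ - a) ^ 2 / 8`), and two consequences for finite sums
`∑ (1 - cos θ p)` under a constraint `π ≤ ∑ θ p` on at least `120` angles in `[0, π]`.
All statements are elementary real analysis (Taylor bounds for `sin`/`cos` from Mathlib).
-/

noncomputable section

namespace Summit.QuantumFields.YangMills.Theorems.CrossoverCertificate.Negative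

open Real Finset

/-- Pointwise strong concavity of `cos` near a small base point: for `0 ≤ a ≤ 1/32` and
`0 ≤ θ ≤ π/4`, the cosine lies below its tangent line at `a` by at least `(θ - a)²/8`.
[folklore] -/
theorem cos_le_taylor_margin : ∀ {a θ : ℝ}, 0 ≤ a → a ≤ 1 / 32 → 0 ≤ θ → θ ≤ Real.pi / 4 → Real.cos θ ≤ Real.cos a - Real.sin a * (θ - a) - (θ - a) ^ 2 / 8 := by
  intro a θ ha0 ha1 hθ0 hθ1
  -- elementary facts about the base point `a`
  have hca1 : Real.cos a ≤ 1 := Real.cos_le_one a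
  have hca0 : 1 - a ^ 2 / 2 ≤ Real.cos a := Real.one_sub_sq_div_two_le_cos
  have hsa0 : 0 ≤ Real.sin a :=
    Real.sin_nonneg_of_nonneg_of_le_pi ha0 (by linarith [Real.pi_gt_three])
  have hsa1 : Real.sin a ≤ a := Real.sin_le ha0
  have ha2 : a * a ≤ 1 / 32 * (1 / 32) := mul_le_mul ha1 ha1 ha0 (by norm_num)
  have hc0 : 0 ≤ Real.cos a := by nlinarith [hca0, ha2]
  -- write `θ = a + h`
  obtain ⟨h, rfl⟩ : ∃ h, θ = a + h := ⟨θ - a, by ring⟩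
  have hh0 : -(1 / 32) ≤ h := by linarith [hθ0, ha1]
  have hh1 : h ≤ 4 / 5 := by linarith [hθ1, ha0, Real.pi_lt_d2]
  have habs : |h| ≤ 1 := abs_le.2 ⟨by linarith [hh0], by linarith [hh1]⟩
  have h4 : |h| ^ 4 = h ^ 4 := by
    rw [← abs_pow]
    exact abs_of_nonneg (by positivity)
  have hcos : Real.cos h ≤ 1 - h ^ 2 / 2 + h ^ 4 * (5 / 96) := by
    have := (abs_le.1 (Real.cos_bound habs)).2
    rw [h4] at this
    linarith [this]
  rw [Real.cos_add, show a + h - a = h by ring]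
  have key1 : Real.cos a * Real.cos h ≤ Real.cos a * (1 - h ^ 2 / 2 + h ^ 4 * (5 / 96)) :=
    mul_le_mul_of_nonneg_left hcos hc0
  have e5 : (1 - 1 / 32 * (1 / 32) / 2) * h ^ 2 ≤ Real.cos a * h ^ 2 :=
    mul_le_mul_of_nonneg_right (by linarith [hca0, ha2]) (sq_nonneg h)
  rcases le_total 0 h with hh | hh
  · -- case `0 ≤ h`: use `h - h³/6 ≤ sin h`
    have hsinh : h - h ^ 3 / 6 ≤ Real.sin h := by
      rcases hh.eq_or_lt with hzero | hpos
      · rw [← hzero]; simp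
      · exact (Real.sin_gt_sub_cube hpos).le
    have key2 : Real.sin a * (h - h ^ 3 / 6) ≤ Real.sin a * Real.sin h :=
      mul_le_mul_of_nonneg_left hsinh hsa0
    have hsq : h ^ 2 ≤ 16 / 25 := by nlinarith [mul_le_mul_of_nonneg_left hh1 hh]
    have e1 : h ^ 3 ≤ 4 / 5 * h ^ 2 := by
      nlinarith [mul_le_mul_of_nonneg_left hh1 (sq_nonneg h)]
    have e2 : h ^ 4 ≤ 16 / 25 * h ^ 2 := by
      nlinarith [mul_le_mul_of_nonneg_left hsq (sq_nonneg h)]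
    have e3 : Real.sin a * h ^ 3 ≤ 1 / 32 * (4 / 5 * h ^ 2) :=
      mul_le_mul (by linarith [hsa1, ha1]) e1 (by positivity) (by norm_num)
    have e4 : Real.cos a * h ^ 4 ≤ 1 * (16 / 25 * h ^ 2) :=
      mul_le_mul hca1 e2 (by positivity) (by norm_num)
    linarith [key1, key2, e3, e4, e5, sq_nonneg h]
  · -- case `h ≤ 0`: use `h ≤ sin h`
    have hsinh : h ≤ Real.sin h := by
      have := Real.sin_le (neg_nonneg.2 hh)
      rw [Real.sin_neg] at this
      linarith [this]
    have key2 : Real.sin a * h ≤ Real.sin a * Real.sin h :=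
      mul_le_mul_of_nonneg_left hsinh hsa0
    have hsq : h ^ 2 ≤ 1 / 32 * (1 / 32) := by
      nlinarith [mul_nonneg (by linarith [hh0] : (0 : ℝ) ≤ h + 1 / 32) (neg_nonneg.2 hh)]
    have e2 : h ^ 4 ≤ 1 / 32 * (1 / 32) * h ^ 2 := by
      nlinarith [mul_le_mul_of_nonneg_left hsq (sq_nonneg h)]
    have e4 : Real.cos a * h ^ 4 ≤ 1 * (1 / 32 * (1 / 32) * h ^ 2) :=
      mul_le_mul hca1 e2 (by positivity) (by norm_num)
    linarith [key1, key2, e4, e5, sq_nonneg h]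

/-- Elementary numerics: for `M ≥ 120` the angle `π / M` is positive and at most `1/32`.
[folklore] -/
theorem frozenTrig_pi_div_bounds {M : ℝ} (hM : 120 ≤ M) : 0 < π / M ∧ π / M ≤ 1 / 32 := by
  have hM0 : 0 < M := by linarith [hM]
  refine ⟨div_pos Real.pi_pos hM0, ?_⟩
  rw [div_le_iff₀ hM0]
  linarith [Real.pi_lt_d2, hM]

/-- Elementary numerics: for `M ≥ 120`, `M (1 - cos (π/M)) + (π/M)²/32 < 29/100`.
[folklore] -/
theorem frozenTrig_rhs_lt {M : ℝ} (hM : 120 ≤ M) :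
    M * (1 - Real.cos (π / M)) + (π / M) ^ 2 / 32 < 29 / 100 := by
  obtain ⟨ha0, ha1⟩ := frozenTrig_pi_div_bounds hM
  have hM0 : 0 < M := by linarith [hM]
  set a := π / M with ha_def
  have hMa : M * a = π := by rw [ha_def]; field_simp
  have h1 : M * (1 - Real.cos a) ≤ M * (a ^ 2 / 2) :=
    mul_le_mul_of_nonneg_left (by linarith [Real.one_sub_sq_div_two_le_cos (x := a)]) hM0.le
  have h2 : M * (a ^ 2 / 2) = π * a / 2 := by rw [← hMa]; ring
  have h3 : π * a ≤ 3.15 * (1 / 32) := mul_le_mul Real.pi_lt_d2.le ha1 ha0.le (by norm_num)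
  have h4 : a * a ≤ 1 / 32 * (1 / 32) := mul_le_mul ha1 ha1 ha0.le (by norm_num)
  nlinarith [h1, h2, h3, h4]

/-- Dichotomy behind the sum bounds: given at least `120` angles in `[0, π]` with total at least
`π`, either one angle exceeds `π/4` (and then `∑ (1 - cos θ p) ≥ 29/100`), or all angles are
at most `π/4` and the strong concavity bound `cos_le_taylor_margin` can be summed.
[folklore] -/
theorem sum_one_sub_cos_dichotomy {ι : Type*} (s : Finset ι) (θ : ι → ℝ) (hM : 120 ≤ s.card)
    (hθ : ∀ p ∈ s, 0 ≤ θ p ∧ θ p ≤ π) (hsum : π ≤ ∑ p ∈ s, θ p) :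
    29 / 100 ≤ ∑ p ∈ s, (1 - Real.cos (θ p)) ∨
      (s.card : ℝ) * (1 - Real.cos (π / s.card)) + ∑ p ∈ s, (θ p - π / s.card) ^ 2 / 8
        ≤ ∑ p ∈ s, (1 - Real.cos (θ p)) := by
  by_cases hA : ∃ p ∈ s, π / 4 < θ p
  · -- one large angle
    obtain ⟨p₀, hp₀, hlt⟩ := hA
    refine Or.inl ?_
    have h2 : Real.sqrt 2 < 71 / 50 := (Real.sqrt_lt' (by norm_num)).2 (by norm_num)
    have hcos := Real.cos_le_cos_of_nonneg_of_le_pi (by positivity) (hθ p₀ hp₀).2 hlt.le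
    rw [Real.cos_pi_div_four] at hcos
    calc (29 : ℝ) / 100 ≤ 1 - Real.cos (θ p₀) := by linarith [hcos, h2]
      _ ≤ ∑ p ∈ s, (1 - Real.cos (θ p)) :=
        Finset.single_le_sum (fun p _ => sub_nonneg.2 (Real.cos_le_one (θ p))) hp₀
  · -- all angles at most `π / 4`
    push Not at hA
    refine Or.inr ?_
    have hM' : (120 : ℝ) ≤ s.card := by exact_mod_cast hM
    obtain ⟨ha0, ha1⟩ := frozenTrig_pi_div_bounds hM'
    have hM0 : (0 : ℝ) < s.card := by linarith [hM']
    set a := π / (s.card : ℝ) with ha_def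
    have hMa : (s.card : ℝ) * a = π := by rw [ha_def]; field_simp
    have hsa0 : 0 ≤ Real.sin a :=
      Real.sin_nonneg_of_nonneg_of_le_pi ha0.le (by linarith [Real.pi_gt_three, ha1])
    have hpt : ∀ p ∈ s,
        (1 - Real.cos a - Real.sin a * a) + Real.sin a * θ p + (θ p - a) ^ 2 / 8
          ≤ 1 - Real.cos (θ p) := fun p hp => by
      have := cos_le_taylor_margin ha0.le ha1 (hθ p hp).1 (hA p hp)
      linarith [this]
    have hS := Finset.sum_le_sum hpt
    rw [Finset.sum_add_distrib, Finset.sum_add_distrib, Finset.sum_const, ← Finset.mul_sum,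
      nsmul_eq_mul] at hS
    have hMsa : (s.card : ℝ) * (Real.sin a * a) = Real.sin a * π := by rw [← hMa]; ring
    have hsin_sum := mul_le_mul_of_nonneg_left hsum hsa0
    linarith [hS, hMsa, hsin_sum]

/-- Sum version of the concavity of `cos`: for at least `120` angles in `[0, π]` with total at
least `π`, `∑ (1 - cos θ p)` is at least its value at the equidistributed configuration
`θ p = π / card`. [folklore] -/
theorem sum_one_sub_cos_ge {ι : Type*} (s : Finset ι) (θ : ι → ℝ) (hM : 120 ≤ s.card)
    (hθ : ∀ p ∈ s, 0 ≤ θ p ∧ θ p ≤ π) (hsum : π ≤ ∑ p ∈ s, θ p) :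
    (s.card : ℝ) * (1 - Real.cos (π / s.card)) ≤ ∑ p ∈ s, (1 - Real.cos (θ p)) := by
  rcases sum_one_sub_cos_dichotomy s θ hM hθ hsum with h | h
  · have hM' : (120 : ℝ) ≤ s.card := by exact_mod_cast hM
    have hlt := frozenTrig_rhs_lt hM'
    linarith [hlt, h, sq_nonneg (π / (s.card : ℝ))]
  · have h0 : 0 ≤ ∑ p ∈ s, (θ p - π / s.card) ^ 2 / 8 :=
      Finset.sum_nonneg fun p _ => by positivity
    linarith [h, h0]

/-- Sum version of the strong concavity of `cos` with a margin: for at least `120` angles in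
`[0, π]` with total at least `π`, if one designated angle `θ q` is at most half the mean
angle `π / card`, then `∑ (1 - cos θ p)` exceeds the equidistributed value by at least
`(π / card)² / 32`. [folklore] -/
theorem sum_one_sub_cos_ge_margin {ι : Type*} (s : Finset ι) (θ : ι → ℝ) (hM : 120 ≤ s.card)
    (hθ : ∀ p ∈ s, 0 ≤ θ p ∧ θ p ≤ π) (hsum : π ≤ ∑ p ∈ s, θ p) {q : ι} (hq : q ∈ s)
    (hsmall : θ q ≤ π / s.card / 2) :
    (s.card : ℝ) * (1 - Real.cos (π / s.card)) + (π / s.card) ^ 2 / 32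
      ≤ ∑ p ∈ s, (1 - Real.cos (θ p)) := by
  have hM' : (120 : ℝ) ≤ s.card := by exact_mod_cast hM
  rcases sum_one_sub_cos_dichotomy s θ hM hθ hsum with h | h
  · have hlt := frozenTrig_rhs_lt hM'
    linarith [hlt, h]
  · have h1 : (θ q - π / s.card) ^ 2 / 8 ≤ ∑ p ∈ s, (θ p - π / s.card) ^ 2 / 8 :=
      Finset.single_le_sum (f := fun p => (θ p - π / s.card) ^ 2 / 8)
        (fun p _ => by positivity) hq
    obtain ⟨ha0, -⟩ := frozenTrig_pi_div_bounds hM'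
    have h2 : (π / s.card) ^ 2 / 32 ≤ (θ q - π / s.card) ^ 2 / 8 := by
      nlinarith [mul_nonneg (by linarith [hsmall] : (0 : ℝ) ≤ π / s.card / 2 - θ q)
        (by linarith [hsmall, ha0] : (0 : ℝ) ≤ 3 * (π / s.card) / 2 - θ q)]
    linarith [h, h1, h2]

end Summit.QuantumFields.YangMills.Theorems.CrossoverCertificate.Negative

end
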